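import Summits.ResolutionOfSingularities.ResolutionOfSingularities.Theorems.EquisingularLiftEquisingularLiftNatSpecimenQ47ForcedMultisection
import HarnessLib

/-!
# [OURS · L1 W4.5(b) · EL♮(3)] Specimen family Q47_k — the NODAL-CARRIER TOWER: chart identities of Q47₂ = V(D² + x¹⁰ + x²⁰ + y²⁰ + z²⁰) through the point step, the
# round at the 8-fold line, the NODAL round at Γ₀ and the round at the nodal section Γ′ (kill side, res-L1-w45b-lead-1 g18, memo `FORCED-MULTISECTION-Q47.md` v1.2 §11;
# crux `EquisingularLiftNatThree`, stmt-ResolutionOfSingularities-20148)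

NOT a statement of any manuscript; OURS kernel specimen (cell `res-hironaka`, chain w45b).  AI-written, weaker than expert review.  Nothing of [Hironaka2017] is asserted;
EL♮(3) is NOT proved here; nothing here proves that Q47₂ is inside or outside any typed cut.  Companion of ✓ `…NatSpecimenQ47ForcedMultisection` (same `D`, same Chebyshev
curve `Γ₀ = {d = 0}`, `d(w,t) = 8t⁴ − 8t² + 1 − T₇(w)`); here the padding is `G₂ = x¹⁰ + x²⁰ + y²⁰ + z²⁰` (weighted degree ≥ 20), which makes the transversal type along `Γ₀`
equal to `A₃` instead of `A₁`, so that after the (downstairs NODAL) round at `Γ₀` the strict transform is singular along a NODAL SECTION `Γ′` of `E_Γ → Γ₀` through the nine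
ordinary double points of the downstairs ambient — the object of the memo's §11 B3 («why k ≥ 2 is outside P⁷ + one nodal round») and of the D8 sizing «nodal-carrier towers».
* `total_P_y₂`  : `F₂ ∘ (X₀X₁, X₁, X₂X₁) = X₁⁸ · F₂,₁`, `F₂,₁ = D̂² + X₁²X₀¹⁰ + X₁¹²(X₀²⁰ + 1 + X₂²⁰)` (point step, chart `y`; `D̂` as in the companion file);
* `total_L_y₂`  : `F₂,₁ ∘ (X₀X₁, X₁, X₂) = X₁⁸ · F₂,₂`, `F₂,₂ = d(X₂,X₀)² + X₁⁴(X₀¹⁰ + 1 + X₂²⁰ + X₁²⁰X₀²⁰)` (round at `ℓ`; transversal type `A₃` along `Γ₀ = V(X₁, d)`: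
  `F₂,₂ ∈ (X₁, d)²` and the `X₁`-adic leading term after `d²` is `X₁⁴·τ₄`, `τ₄ = X₀¹⁰ + 1 + X₂²⁰`);
* `nodal_round`  : the NODAL round `Bl_{(y,d)}` in the chart `d = β·y` is the ring identity `d² + y⁴τ = (d − βy)(d + βy) + y²·(β² + y²τ)` — modulo the chart relation `d = βy`
  the strict transform is `T̃″ = β² + y²τ`, singular along `Γ′ = V(β, y)` (`T̃″ ∈ (β, y)²`: `nodal_round_mem_sq`); the chart ambient `V(d − βy) ⊂ 𝔸⁴` has gradient
  `(∂d/∂w, ∂d/∂t, −y, −β)`, which vanishes exactly over the nine nodes of `Γ₀` at `y = β = 0` (`node_minus`/`node_plus` of the companion file): nine ordinary double points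
  ON `Γ′`; the other chart `y = α·d`: `d² + (αd)⁴τ = d²·(1 + α⁴d²τ)` (`nodal_round_other`) — the strict transform `1 + α⁴d²τ` does not meet `E_Γ = V(d)` there;
* `second_round` : the round at `Γ′` in the chart `β = γ·y`: `β² + y²τ = … ` i.e. `(γy)² + y²τ = y²·(γ² + τ)` and the ambient relation becomes `d = γ·y²`, whose gradient
  `(∂d/∂w, ∂d/∂t, −2γy, −y²)` vanishes along the whole LINE `{y = 0} × 𝔸¹_γ` over each node (a `cA₁` line), on which the strict transform `γ² + τ₄` vanishes at the two points
  `γ² = −τ₄(node)` — the `A₁` leaves at ambient-singular points of the memo's §11 B3.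
All statements are `ring` identities over an arbitrary commutative ring `R` (resp. explicit ideal-membership witnesses).  Measured counterpart: kit j323478 (`q47/q47k.sage`:
`T̃′ = d² + y⁴(t¹⁰ + 1 + w²⁰) + …`, `Sing H = {x₀}` and nothing at infinity for `p ∈ {19, 23, 29, 31, 10007, 10009}`, `τ₄` a unit at the nodes).
-/

set_option linter.dupNamespace false -- mandated namespace `Summit.<Summit>.<Problem>` of this single-conjunct summit

noncomputable section

open MvPolynomial

namespace Summit.ResolutionOfSingularities.ResolutionOfSingularities.Cruxes.EquisingularLiftNat.Sections

namespace SpecimenQ47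

variable (R : Type) [CommRing R]

/-- [OURS · L1 W4.5b] Q47₂, point step at `x₀`, chart `y`: `F₂ ∘ (X₀X₁, X₁, X₂X₁) = X₁⁸ · (D̂² + X₁²X₀¹⁰ + X₁¹²(X₀²⁰ + 1 + X₂²⁰))`. [folklore] -/
theorem total_P_y₂ :
    bind₁ (![X 0 * X 1, X 1, X 2 * X 1] : Fin 3 → MvPolynomial (Fin 3) R)
        ((8 * X 0 ^ 4 - 8 * X 0 ^ 2 * X 1 ^ 4 + X 1 ^ 8 - X 1 * (64 * X 2 ^ 7 - 112 * X 2 ^ 5 * X 1 ^ 2 + 56 * X 2 ^ 3 * X 1 ^ 4 - 7 * X 2 * X 1 ^ 6)) ^ 2 +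
          (X 0 ^ 10 + X 0 ^ 20 + X 1 ^ 20 + X 2 ^ 20) : MvPolynomial (Fin 3) R) =
      X 1 ^ 8 * ((8 * X 0 ^ 4 - 8 * X 0 ^ 2 * X 1 ^ 2 + (1 - (64 * X 2 ^ 7 - 112 * X 2 ^ 5 + 56 * X 2 ^ 3 - 7 * X 2)) * X 1 ^ 4) ^ 2 +
        X 1 ^ 2 * X 0 ^ 10 + X 1 ^ 12 * (X 0 ^ 20 + 1 + X 2 ^ 20)) := by
  simp only [map_add, map_sub, map_pow, map_mul, map_ofNat, bind₁_X_right]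
  simp only [Matrix.cons_val_zero, Matrix.cons_val_one, Matrix.cons_val_two, Matrix.tail_cons, Matrix.head_cons]
  ring

/-- [OURS · L1 W4.5b] Q47₂, round at `ℓ`, chart `x' = X₀X₁`: `… = X₁⁸ · (d(X₂,X₀)² + X₁⁴(X₀¹⁰ + 1 + X₂²⁰ + X₁²⁰X₀²⁰))` — transversal type `A₃` along `Γ₀`. [folklore] -/
theorem total_L_y₂ :
    bind₁ (![X 0 * X 1, X 1, X 2] : Fin 3 → MvPolynomial (Fin 3) R)
        ((8 * X 0 ^ 4 - 8 * X 0 ^ 2 * X 1 ^ 2 + (1 - (64 * X 2 ^ 7 - 112 * X 2 ^ 5 + 56 * X 2 ^ 3 - 7 * X 2)) * X 1 ^ 4) ^ 2 +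
          X 1 ^ 2 * X 0 ^ 10 + X 1 ^ 12 * (X 0 ^ 20 + 1 + X 2 ^ 20) : MvPolynomial (Fin 3) R) =
      X 1 ^ 8 * ((8 * X 0 ^ 4 - 8 * X 0 ^ 2 + 1 - (64 * X 2 ^ 7 - 112 * X 2 ^ 5 + 56 * X 2 ^ 3 - 7 * X 2)) ^ 2 +
        X 1 ^ 4 * (X 0 ^ 10 + 1 + X 2 ^ 20 + X 1 ^ 20 * X 0 ^ 20)) := by
  simp only [map_add, map_sub, map_pow, map_mul, map_ofNat, map_one, bind₁_X_right]
  simp only [Matrix.cons_val_zero, Matrix.cons_val_one, Matrix.cons_val_two, Matrix.tail_cons, Matrix.head_cons]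
  ring

variable {R}

/-- [OURS · L1 W4.5b] The NODAL round `Bl_{(y,d)}`, chart `d = β·y`: `d² + y⁴τ = (d − βy)(d + βy) + y²(β² + y²τ)` — modulo the chart relation `d = βy` the total transform is
`y²` times the strict transform `T̃″ = β² + y²τ` (any `d, β, y, τ`; for Q47₂, `τ = τ₄`; for Q47 itself replace `y⁴τ` by `y²τ₂`: `d² + y²τ₂ = (d − βy)(d + βy) + y²(β² + τ₂)`,
`nodal_round₁`). [folklore] -/
theorem nodal_round (d β y τ : R) : d ^ 2 + y ^ 4 * τ = (d - β * y) * (d + β * y) + y ^ 2 * (β ^ 2 + y ^ 2 * τ) := by ring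

/-- [OURS · L1 W4.5b] The same identity for Q47 (transversal `A₁`): `d² + y²τ₂ = (d − βy)(d + βy) + y²(β² + τ₂)`; here `T̃″ = β² + τ₂` does not vanish at `y = β = 0` over a
node where `τ₂` is a unit — the strict transform misses the nine ordinary double points (memo §11 B2; kit j323456 (P3): it is even regular). [folklore] -/
theorem nodal_round₁ (d β y τ₂ : R) : d ^ 2 + y ^ 2 * τ₂ = (d - β * y) * (d + β * y) + y ^ 2 * (β ^ 2 + τ₂) := by ring

/-- [OURS · L1 W4.5b] After the nodal round of Q47₂ the strict transform `T̃″ = β² + y²τ` lies in `(β, y)²`: it is singular along the whole section `Γ′ = V(β, y)` of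
`E_Γ = V(y) → Γ₀` (which, in the chart ambient `V(d − βy)`, passes through the nine double points `(node, y = 0, β = 0)`). [folklore] -/
theorem nodal_round_mem_sq : (X 0 ^ 2 + X 1 ^ 2 * X 2 : MvPolynomial (Fin 3) R) ∈ (Ideal.span {X 0, X 1} : Ideal (MvPolynomial (Fin 3) R)) ^ 2 := by
  have h0 : (X 0 : MvPolynomial (Fin 3) R) ∈ (Ideal.span {X 0, X 1} : Ideal (MvPolynomial (Fin 3) R)) := Ideal.subset_span (by simp)
  have h1 : (X 1 : MvPolynomial (Fin 3) R) ∈ (Ideal.span {X 0, X 1} : Ideal (MvPolynomial (Fin 3) R)) := Ideal.subset_span (by simp)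
  refine Ideal.add_mem _ ?_ ?_
  · simpa only [pow_two] using Ideal.mul_mem_mul h0 h0
  · exact Ideal.mul_mem_right _ _ (by simpa only [pow_two] using Ideal.mul_mem_mul h1 h1)

/-- [OURS · L1 W4.5b] The other chart `y = α·d` of the nodal round: `d² + (αd)⁴τ = d²·(1 + α⁴d²τ)` — the strict transform `1 + α⁴d²τ` equals `1` on `E_Γ = V(d)`: it does not
meet the exceptional divisor in this chart (so `Γ′` is the section `β = 0`, opposite to `St E_ℓ ∩ E_Γ = V(α)`). [folklore] -/
theorem nodal_round_other (d α τ : R) : d ^ 2 + (α * d) ^ 4 * τ = d ^ 2 * (1 + α ^ 4 * d ^ 2 * τ) := by ring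

/-- [OURS · L1 W4.5b] The gradient of the chart ambient `Φ = d(w,t) − β·y` of the nodal round: `∂Φ/∂y = −β`, `∂Φ/∂β = −y`, and at a node of `Γ₀` (where `∂d/∂w = ∂d/∂t = 0`,
companion file `node_minus`/`node_plus`) with `y = β = 0` all four partials vanish while the Hessian in `(y, β)` is the hyperbolic form `−(dy·dβ + dβ·dy)`: together with the
node's own Hessian in `(w,t)` (`hessian_ne_zero`) the point is an ORDINARY DOUBLE POINT `uv = βy` of the 3-fold.  Recorded as the Taylor identity of `Φ` in `(y, β)`. [folklore] -/
theorem ambient_taylor (d y β y₀ β₀ : R) :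
    d - β * y = (d - β₀ * y₀) - β₀ * (y - y₀) - y₀ * (β - β₀) - (y - y₀) * (β - β₀) := by ring

/-- [OURS · L1 W4.5b] The round at the nodal section `Γ′ = V(β, y)`, chart `β = γ·y`: `(γy)² + y²τ = y²·(γ² + τ)` (strict transform `γ² + τ`), and the ambient relation
`d = βy` becomes `d = γ·y²`, i.e. `d − (γy)·y = d − γy²`; along `y = 0` over a node ALL partials of `d − γy²` vanish for EVERY `γ` (`∂/∂γ = −y² = 0`, `∂/∂y = −2γy = 0`):
the new downstairs ambient is singular along the nine LINES over the double points, and the strict transform `γ² + τ₄` meets such a line in the two points `γ² = −τ₄(node)`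
(kit j323478: `τ₄` is a unit at the nodes) — the `A₁` leaves at ambient-singular points. [folklore] -/
theorem second_round (d γ y τ : R) :
    (γ * y) ^ 2 + y ^ 2 * τ = y ^ 2 * (γ ^ 2 + τ) ∧ d - (γ * y) * y = d - γ * y ^ 2 := by
  constructor <;> ring

end SpecimenQ47

end Summit.ResolutionOfSingularities.ResolutionOfSingularities.Cruxes.EquisingularLiftNat.Sections

end
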